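import Summits.Ventures.DiscreteObjects.Hadamard.AutomorphismTransfer668
import Summits.Ventures.DiscreteObjects.Hadamard.Order167Normalizer668
import Summits.Ventures.DiscreteObjects.Hadamard.NormalizerOrbitTools
import Summits.Ventures.DiscreteObjects.Hadamard.GramTwoSquares
import Summits.Ventures.DiscreteObjects.Hadamard.GSRowSums167

/-!
# H(668) census, row F11: the CONFERENCE-MATRIX ROUTE `C(334) ⇒ H(668)` in the kernel, its two-circulant form,
# and the multiplier-symmetric sub-family decided EMPTY

Framing: lottery ticket; floor = certified bounds/negative ranges.  Cell pub-namedobj (venture DiscreteObjects),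
target (H), hadamard gen 27.  TABLE-H row F11 had no kernel column.  A conference matrix of order `m` is a `{0, ±1}`
matrix `C` with zero diagonal, `±1` elsewhere and `C Cᵀ = (m − 1)·I` (Seberry–Yamada 2020, Def. 1.55); a `C(334)` is not
known (it would give the open `H(668)`; `333 = 3²·37` is not a prime power, so no construction in print applies).
* §1 `conference_double_isHadamard`: **`[[C + I, C − I], [Cᵀ − I, −Cᵀ − I]]` is a Hadamard matrix of order `2m` for
  EVERY conference matrix `C` of order `m`** (classically stated for symmetric `C`: J. Wallis 1972 = Seberry–Yamada 2020
  Thm 12.7 / §A.1.4; the symmetry is not needed since `(C+I)(C−I) = (C−I)(C+I)` and `CᵀC = CCᵀ` over `ℤ` by the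
  adjugate); `hadamard668_of_conference334` (**any `C(334)` gives an `H(668)`** — the HIT protocol of row F11);
  `conference334_twoSquares_test`: the printed necessary condition (`m ≡ 2 (mod 4)` ⇒ `m − 1 = x² + y²`, Raghavarao; gen-13
  kernel theorem `nat_sq_add_sq_of_int_mul_transpose_self`) is PASSED at `334` (`333 = 18² + 3²`), so it excludes nothing.
* §2 two-circulant ('2C-type', Balonin–Đoković 2015: `[[A, B], [−Bᵀ, Aᵀ]]`) conference matrices from a CONFERENCE PAIR
  of length `v` (`a 0 = 0`, `a x = ±1` for `x ≠ 0`, `b` `±1`-valued, `PAF_a(s) + PAF_b(s) = 0` for `s ≠ 0`): `confPair_gram`,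
  `hadamard_of_confPair` (order `4v`), `hadamard668_of_confPair167`; `(+)` CONTROL `hadamard20_of_confPair5`
  (`(χ₅, J − 2δ₀)` ⇒ Paley `C(10)` ⇒ `H(20)`, pair condition by kernel evaluation).
* §3 grammar: `confPair_rowsum_sq` (`(Σa)² + (Σb)² = 2v − 1`); **`confPair167_rowsums`: `|Σa| = 18`, `|Σb| = 3`**.
* §4 **census (negative line): no conference pair of length `167` has a multiplier symmetry `a (h x) = ε a x` or an
  affine symmetry `b (h x + c) = ε b x` with `h² ≠ 1`** (`confPair167_no_multiplierA`, `confPair167_no_affineB`; `ε = ±1`,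
  `h = 0` included) — so no symmetry from the subgroups of order `83`, `166` of `(ℤ/167)ˣ`: the row acquires a
  square-invariant translate (`exists_translate_inv4_of_affine`, from gen 20's `inv4_of_hInvariant` and
  `exists_translate_hInvariant_prime`), whose row sum is `x 0 + 83 (x 1 + x (−1))` (`rowsum_of_inv4`, gen 2's `eq_blk`),
  i.e. in `{0, ±166}` resp. `{±1, ±165, ±167}`, never `±18` resp. `±3`.  `h = ±1` is the open, unstructured residue.
WORDS: plug-in + negative symmetry line about a hypothetical object; no order excluded; `C(334)`, `H(668)` untouched.  Ours
(formalisation; §1's symmetric case and §2's array are the classical constructions); no `sorry`.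
-/


namespace Summit.Ventures.DiscreteObjects.Hadamard

open Finset BigOperators Matrix

open Literature.Combinatorics.Designs.GoethalsSeidel (IsHadamardMatrix circT circT_apply transpose_circT
  circT_mul_circulant circulant_mul_circT_apply)
open Literature.Combinatorics.Designs.LegendrePairs (PAF IsPM HInvariant TwistedInvariant sq_rowsum paf_zero)

/-! ## §1 The doubling `C(m) ⇒ H(2m)` -/

section doubling
variable {ι : Type*} [Fintype ι] [DecidableEq ι]

/-- `Cᵀ C = k·1` from `C Cᵀ = k·1` over `ℤ`, for every `k` (the case `k = 0` forces `C = 0`). -/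
lemma transpose_mul_self_of_mul_transpose_any (C : Matrix ι ι ℤ) (k : ℤ) (h : C * Cᵀ = k • (1 : Matrix ι ι ℤ)) :
    Cᵀ * C = k • (1 : Matrix ι ι ℤ) := by
  by_cases hk : k = 0
  · subst hk
    have hC : C = 0 := by
      ext i j
      have e := congrFun (congrFun h i) i
      rw [Matrix.mul_apply, zero_smul, Matrix.zero_apply] at e
      simp only [Matrix.transpose_apply] at e
      have h0 := (Finset.sum_eq_zero_iff_of_nonneg (fun x _ => mul_self_nonneg (C i x))).mp e j (Finset.mem_univ j)
      exact mul_self_eq_zero.mp h0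
    rw [hC, Matrix.transpose_zero, Matrix.mul_zero, zero_smul]
  · exact transpose_mul_self_of_mul_transpose C k hk h

/-- **The conference doubling.**  For a conference matrix `C` of order `m` (zero diagonal, `±1` elsewhere,
`C Cᵀ = (m − 1) I`) the block matrix `[[C + I, C − I], [Cᵀ − I, −Cᵀ − I]]` is a Hadamard matrix of order `2m`.
(Symmetric `C`: J. Wallis 1972 / Seberry–Yamada 2020 Thm 12.7; the symmetry is not needed.) -/
theorem conference_double_isHadamard (C : Matrix ι ι ℤ) (hdiag : ∀ i, C i i = 0)
    (hoff : ∀ i j, i ≠ j → C i j = 1 ∨ C i j = -1)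
    (hC : C * Cᵀ = ((Fintype.card ι : ℤ) - 1) • (1 : Matrix ι ι ℤ)) :
    IsHadamardMatrix (Matrix.fromBlocks (C + 1) (C - 1) (Cᵀ - 1) (-Cᵀ - 1)) := by
  set k : ℤ := (Fintype.card ι : ℤ) - 1 with hk
  have hCt : Cᵀ * C = k • (1 : Matrix ι ι ℤ) := transpose_mul_self_of_mul_transpose_any C k hC
  have hpm : ∀ i j (t : ℤ), (t = 1 ∨ t = -1) → i ≠ j → C i j * t = 1 ∨ C i j * t = -1 := by
    rintro i j t (rfl | rfl) hij <;> rcases hoff i j hij with h | h <;> rw [h] <;> norm_num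
  refine ⟨?_, ?_⟩
  · rintro (i | i) (j | j) <;>
      simp only [Matrix.fromBlocks_apply₁₁, Matrix.fromBlocks_apply₁₂, Matrix.fromBlocks_apply₂₁,
        Matrix.fromBlocks_apply₂₂, Matrix.add_apply, Matrix.sub_apply, Matrix.neg_apply, Matrix.transpose_apply,
        Matrix.one_apply] <;>
      by_cases hij : i = j <;> simp only [hij, if_true, if_false, hdiag, add_zero, sub_zero] <;>
      first
        | decide
        | simpa using hpm i j 1 (Or.inl rfl) hij
        | simpa using hpm j i 1 (Or.inl rfl) (Ne.symm hij)
        | simpa using hpm j i (-1) (Or.inr rfl) (Ne.symm hij)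
  · have twice : k • (1 : Matrix ι ι ℤ) + k • (1 : Matrix ι ι ℤ) + (1 + 1) = (2 * (k + 1)) • (1 : Matrix ι ι ℤ) := by
      ext i j; simp only [Matrix.add_apply, Matrix.smul_apply, Matrix.one_apply, smul_eq_mul]; split_ifs <;> ring
    have h1 : (C + 1) * (Cᵀ + 1) + (C - 1) * (Cᵀ - 1) = (2 * (k + 1)) • (1 : Matrix ι ι ℤ) := by
      rw [← twice, ← hC]; noncomm_ring
    have h2 : (C + 1) * (C - 1) + (C - 1) * (-C - 1) = 0 := by noncomm_ring
    have h3 : (Cᵀ - 1) * (Cᵀ + 1) + (-Cᵀ - 1) * (Cᵀ - 1) = 0 := by noncomm_ring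
    have h4 : (Cᵀ - 1) * (C - 1) + (-Cᵀ - 1) * (-C - 1) = (2 * (k + 1)) • (1 : Matrix ι ι ℤ) := by
      rw [← twice, ← hCt]; noncomm_ring
    have hcard : (Fintype.card (ι ⊕ ι) : ℤ) = 2 * (k + 1) := by
      rw [Fintype.card_sum, hk]; push_cast; ring
    simp only [Matrix.fromBlocks_transpose, Matrix.transpose_add, Matrix.transpose_sub, Matrix.transpose_neg,
      Matrix.transpose_one, Matrix.transpose_transpose, Matrix.fromBlocks_multiply]
    rw [h1, h2, h3, h4, hcard, ← Matrix.fromBlocks_one, Matrix.fromBlocks_smul, smul_zero]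

/-- **Row F11, HIT protocol: any conference matrix of order `334` gives a Hadamard matrix of order `668`.** -/
theorem hadamard668_of_conference334 (hι : Fintype.card ι = 334) (C : Matrix ι ι ℤ) (hdiag : ∀ i, C i i = 0)
    (hoff : ∀ i j, i ≠ j → C i j = 1 ∨ C i j = -1) (hC : C * Cᵀ = (333 : ℤ) • (1 : Matrix ι ι ℤ)) :
    IsHadamardMatrix (Matrix.fromBlocks (C + 1) (C - 1) (Cᵀ - 1) (-Cᵀ - 1)) ∧ Fintype.card (ι ⊕ ι) = 668 := by
  refine ⟨conference_double_isHadamard C hdiag hoff ?_, by rw [Fintype.card_sum, hι]⟩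
  rw [hC, hι]; norm_num

/-- the printed necessary condition at `334 ≡ 2 (mod 4)` (Raghavarao: `m − 1` a sum of two squares) in the kernel:
any integer `C` on `334` coordinates with `C Cᵀ = 333·I` forces `333 = x² + y²` — which HOLDS (`18² + 3²`), so the
test does not exclude `C(334)` (second component: `333 = 18² + 3²`). -/
theorem conference334_twoSquares_test (hι : Fintype.card ι = 334) (C : Matrix ι ι ℤ)
    (hC : C * Cᵀ = (333 : ℤ) • (1 : Matrix ι ι ℤ)) : (∃ x y : ℕ, 333 = x ^ 2 + y ^ 2) ∧ (333 : ℕ) = 18 ^ 2 + 3 ^ 2 :=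
  ⟨nat_sq_add_sq_of_int_mul_transpose_self C 333 (by exact_mod_cast hC) (by rw [hι]), by norm_num⟩

end doubling

/-! ## §2 Two-circulant (2C-type) conference matrices from a conference pair -/

section twoCirculant
variable {n : ℕ} [NeZero n]

/-- transposed circulants commute. -/
private lemma circT_comm (x y : ZMod n → ℤ) : circT x * circT y = circT y * circT x := by
  show circulant _ * circulant _ = circulant _ * circulant _
  exact Matrix.circulant_mul_comm _ _

omit [NeZero n] in
/-- `(circulant x)ᵀ = circT x`. -/
private lemma transpose_circulant_eq (x : ZMod n → ℤ) : (circulant x)ᵀ = circT x := Matrix.transpose_circulant x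

/-- `PAF_a(0) = n − 1` for a sequence with `a 0 = 0` and `±1` elsewhere. -/
lemma paf_zero_of_core (a : ZMod n → ℤ) (ha0 : a 0 = 0) (ha : ∀ i, i ≠ 0 → a i = 1 ∨ a i = -1) :
    PAF a 0 = (n : ℤ) - 1 := by
  unfold PAF
  have h : ∀ i : ZMod n, a i * a (i + 0) = 1 - (if i = 0 then 1 else 0) := by
    intro i; rw [add_zero]
    split_ifs with hi
    · rw [hi, ha0]; norm_num
    · rcases ha i hi with e | e <;> rw [e] <;> norm_num
  rw [Finset.sum_congr rfl (fun i _ => h i), Finset.sum_sub_distrib, Finset.sum_const, Finset.card_univ,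
    ZMod.card, Finset.sum_ite_eq' Finset.univ (0 : ZMod n) (fun _ => (1 : ℤ))]
  simp

/-- **Gram identity of the 2C array.**  For a conference pair `(a, b)` of length `n` the two-circulant matrix
`C = [[A, B], [−Bᵀ, Aᵀ]]` (`A, B` the circulants of `a, b`) has `C Cᵀ = (2n − 1)·I`. -/
theorem confPair_gram (a b : ZMod n → ℤ) (ha0 : a 0 = 0) (ha : ∀ i, i ≠ 0 → a i = 1 ∨ a i = -1) (hb : IsPM b)
    (hab : ∀ s : ZMod n, s ≠ 0 → PAF a s + PAF b s = 0) :
    Matrix.fromBlocks (circulant a) (circulant b) (-circT b) (circT a) *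
        (Matrix.fromBlocks (circulant a) (circulant b) (-circT b) (circT a))ᵀ =
      ((Fintype.card (ZMod n ⊕ ZMod n) : ℤ) - 1) • (1 : Matrix (ZMod n ⊕ ZMod n) (ZMod n ⊕ ZMod n) ℤ) := by
  have hg : circulant a * circT a + circulant b * circT b = ((2 * n : ℤ) - 1) • (1 : Matrix (ZMod n) (ZMod n) ℤ) := by
    ext i k
    rw [Matrix.add_apply, circulant_mul_circT_apply, circulant_mul_circT_apply, Matrix.smul_apply, Matrix.one_apply,
      smul_eq_mul]
    by_cases hik : i = k
    · subst hik; rw [sub_self, paf_zero_of_core a ha0 ha, paf_zero b hb, if_pos rfl]; ring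
    · have hki : k - i ≠ 0 := sub_ne_zero.mpr (Ne.symm hik)
      rw [hab _ hki, if_neg hik, mul_zero]
  have hcard : (Fintype.card (ZMod n ⊕ ZMod n) : ℤ) - 1 = 2 * n - 1 := by
    rw [Fintype.card_sum, ZMod.card]; push_cast; ring
  have h2 : circulant a * -circulant b + circulant b * circulant a = 0 := by
    rw [Matrix.mul_neg, Matrix.circulant_mul_comm b a, neg_add_cancel]
  have h3 : -circT b * circT a + circT a * circT b = 0 := by
    rw [Matrix.neg_mul, circT_comm b a, neg_add_cancel]
  have h4 : -circT b * -circulant b + circT a * circulant a = ((2 * n : ℤ) - 1) • (1 : Matrix (ZMod n) (ZMod n) ℤ) := by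
    rw [Matrix.neg_mul, Matrix.mul_neg, neg_neg, circT_mul_circulant, circT_mul_circulant, add_comm, hg]
  rw [Matrix.fromBlocks_transpose, transpose_circulant_eq, transpose_circulant_eq, Matrix.transpose_neg,
    transpose_circT, transpose_circT, Matrix.fromBlocks_multiply, hg, h2, h3, h4, hcard, ← Matrix.fromBlocks_one,
    Matrix.fromBlocks_smul, smul_zero]

omit [NeZero n] in
/-- the 2C array has zero diagonal. -/
theorem confPair_diag (a b : ZMod n → ℤ) (ha0 : a 0 = 0) (p : ZMod n ⊕ ZMod n) :
    Matrix.fromBlocks (circulant a) (circulant b) (-circT b) (circT a) p p = 0 := by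
  rcases p with i | i
  · rw [Matrix.fromBlocks_apply₁₁, Matrix.circulant_apply, sub_self, ha0]
  · rw [Matrix.fromBlocks_apply₂₂, circT_apply, sub_self, ha0]

omit [NeZero n] in
/-- the 2C array is `±1` off the diagonal. -/
theorem confPair_offdiag (a b : ZMod n → ℤ) (ha : ∀ i, i ≠ 0 → a i = 1 ∨ a i = -1) (hb : IsPM b)
    (p q : ZMod n ⊕ ZMod n) (hpq : p ≠ q) :
    Matrix.fromBlocks (circulant a) (circulant b) (-circT b) (circT a) p q = 1 ∨
      Matrix.fromBlocks (circulant a) (circulant b) (-circT b) (circT a) p q = -1 := by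
  rcases p with i | i <;> rcases q with j | j
  · rw [Matrix.fromBlocks_apply₁₁, Matrix.circulant_apply]
    exact ha _ (sub_ne_zero.mpr (fun h => hpq (by rw [h])))
  · rw [Matrix.fromBlocks_apply₁₂, Matrix.circulant_apply]; exact hb _
  · rw [Matrix.fromBlocks_apply₂₁, Matrix.neg_apply, circT_apply]; rcases hb (j - i) with h | h <;> rw [h] <;> decide
  · rw [Matrix.fromBlocks_apply₂₂, circT_apply]
    exact ha _ (sub_ne_zero.mpr (fun h => hpq (by rw [h])))

/-- **2C-type conference matrix ⇒ Hadamard matrix of order `4n`.**  A conference pair of length `n` gives, through the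
2C array and the doubling, a Hadamard matrix of order `4n`. -/
theorem hadamard_of_confPair (a b : ZMod n → ℤ) (ha0 : a 0 = 0) (ha : ∀ i, i ≠ 0 → a i = 1 ∨ a i = -1) (hb : IsPM b)
    (hab : ∀ s : ZMod n, s ≠ 0 → PAF a s + PAF b s = 0) :
    IsHadamardMatrix
      (Matrix.fromBlocks (Matrix.fromBlocks (circulant a) (circulant b) (-circT b) (circT a) + 1)
        (Matrix.fromBlocks (circulant a) (circulant b) (-circT b) (circT a) - 1)
        ((Matrix.fromBlocks (circulant a) (circulant b) (-circT b) (circT a))ᵀ - 1)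
        (-(Matrix.fromBlocks (circulant a) (circulant b) (-circT b) (circT a))ᵀ - 1)) ∧
    Fintype.card ((ZMod n ⊕ ZMod n) ⊕ (ZMod n ⊕ ZMod n)) = 4 * n :=
  ⟨conference_double_isHadamard _ (confPair_diag a b ha0) (confPair_offdiag a b ha hb) (confPair_gram a b ha0 ha hb hab),
    by simp only [Fintype.card_sum, ZMod.card]; ring⟩

/-- **Row F11, two-circulant sub-family: a conference pair of length `167` gives `C(334)` and hence `H(668)`.** -/
theorem hadamard668_of_confPair167 (a b : ZMod 167 → ℤ) (ha0 : a 0 = 0) (ha : ∀ i, i ≠ 0 → a i = 1 ∨ a i = -1)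
    (hb : IsPM b) (hab : ∀ s : ZMod 167, s ≠ 0 → PAF a s + PAF b s = 0) :
    ∃ H : Matrix ((ZMod 167 ⊕ ZMod 167) ⊕ (ZMod 167 ⊕ ZMod 167)) ((ZMod 167 ⊕ ZMod 167) ⊕ (ZMod 167 ⊕ ZMod 167)) ℤ,
      IsHadamardMatrix H ∧ Fintype.card ((ZMod 167 ⊕ ZMod 167) ⊕ (ZMod 167 ⊕ ZMod 167)) = 668 :=
  ⟨_, (hadamard_of_confPair a b ha0 ha hb hab).1, by simp only [Fintype.card_sum, ZMod.card]⟩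

/-- **(+) control of the F11 pipeline at `n = 5`**: the conference pair `(χ₅, J − 2δ₀)` (`a = (0,1,−1,−1,1)`,
`b = (−1,1,1,1,1)`) satisfies the pair condition (kernel evaluation), so the pipeline (`hadamard_of_confPair`: 2C array, then
doubling) yields a Hadamard matrix of order `20` (Paley `C(10)` doubled). -/
theorem hadamard20_of_confPair5 :
    ∃ a b : ZMod 5 → ℤ, a 0 = 0 ∧ (∀ i, i ≠ 0 → a i = 1 ∨ a i = -1) ∧ IsPM b ∧
      (∀ s : ZMod 5, s ≠ 0 → PAF a s + PAF b s = 0) ∧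
      ∃ H : Matrix ((ZMod 5 ⊕ ZMod 5) ⊕ (ZMod 5 ⊕ ZMod 5)) ((ZMod 5 ⊕ ZMod 5) ⊕ (ZMod 5 ⊕ ZMod 5)) ℤ,
        IsHadamardMatrix H ∧ Fintype.card ((ZMod 5 ⊕ ZMod 5) ⊕ (ZMod 5 ⊕ ZMod 5)) = 20 := by
  have hpm : IsPM (fun i : ZMod 5 => if i = 0 then (-1 : ℤ) else 1) := by unfold IsPM; decide
  have ha0 : (fun i : ZMod 5 => if i = 0 then (0 : ℤ) else if i = 1 ∨ i = 4 then 1 else -1) 0 = 0 := by decide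
  have ha : ∀ i : ZMod 5, i ≠ 0 → (fun i : ZMod 5 => if i = 0 then (0 : ℤ) else if i = 1 ∨ i = 4 then 1 else -1) i = 1 ∨
      (fun i : ZMod 5 => if i = 0 then (0 : ℤ) else if i = 1 ∨ i = 4 then 1 else -1) i = -1 := by decide
  have hab : ∀ s : ZMod 5, s ≠ 0 → PAF (fun i : ZMod 5 => if i = 0 then (0 : ℤ) else if i = 1 ∨ i = 4 then 1 else -1) s +
      PAF (fun i : ZMod 5 => if i = 0 then (-1 : ℤ) else 1) s = 0 := by decide
  obtain ⟨hH, -⟩ := hadamard_of_confPair _ _ ha0 ha hpm hab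
  exact ⟨_, _, ha0, ha, hpm, hab, _, hH, by simp only [Fintype.card_sum, ZMod.card]⟩

end twoCirculant

/-! ## §3 The grammar of a conference pair: row sums -/

section rowsums
variable {n : ℕ} [NeZero n]

/-- `(Σa)² + (Σb)² = 2n − 1` for a conference pair of length `n` (PSD at frequency `0`). -/
theorem confPair_rowsum_sq (a b : ZMod n → ℤ) (ha0 : a 0 = 0) (ha : ∀ i, i ≠ 0 → a i = 1 ∨ a i = -1) (hb : IsPM b)
    (hab : ∀ s : ZMod n, s ≠ 0 → PAF a s + PAF b s = 0) :
    (∑ i, a i) ^ 2 + (∑ i, b i) ^ 2 = 2 * n - 1 := by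
  rw [sq_rowsum, sq_rowsum, ← Finset.sum_add_distrib,
    Finset.sum_eq_single (0 : ZMod n) (fun s _ hs => hab s hs) (fun h => absurd (Finset.mem_univ _) h),
    paf_zero_of_core a ha0 ha, paf_zero b hb]
  ring

/-- `x² + y² = 333` in integers forces `{|x|, |y|} = {18, 3}`. -/
lemma sq_add_sq_eq_333 {x y : ℤ} (h : x ^ 2 + y ^ 2 = 333) :
    (x.natAbs = 18 ∧ y.natAbs = 3) ∨ (x.natAbs = 3 ∧ y.natAbs = 18) := by
  have hpq : (x.natAbs : ℤ) ^ 2 + (y.natAbs : ℤ) ^ 2 = 333 := by rw [Int.natAbs_pow_two, Int.natAbs_pow_two]; exact h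
  set p := x.natAbs; set q := y.natAbs
  have hpq' : p ^ 2 + q ^ 2 = 333 := by exact_mod_cast hpq
  have hp : p ≤ 18 := by nlinarith
  have hq : q ≤ 18 := by nlinarith
  interval_cases p <;> interval_cases q <;> omega

/-- **Grammar at `v = 167`: a conference pair of length `167` has `|Σa| = 18` and `|Σb| = 3`.** -/
theorem confPair167_rowsums (a b : ZMod 167 → ℤ) (ha0 : a 0 = 0) (ha : ∀ i, i ≠ 0 → a i = 1 ∨ a i = -1)
    (hb : IsPM b) (hab : ∀ s : ZMod 167, s ≠ 0 → PAF a s + PAF b s = 0) :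
    (∑ i, a i).natAbs = 18 ∧ (∑ i, b i).natAbs = 3 := by
  have h := confPair_rowsum_sq a b ha0 ha hb hab
  norm_num at h
  have hbodd : Odd (∑ i, b i) := rowsum_odd b hb ⟨83, by norm_num⟩
  rcases sq_add_sq_eq_333 h with ⟨h1, h2⟩ | ⟨h1, h2⟩
  · exact ⟨h1, h2⟩
  · exfalso
    obtain ⟨k, hk⟩ := hbodd
    omega

end rowsums

/-! ## §4 Census: square-invariant rows and the exclusion of multiplier symmetries with `h² ≠ 1` -/

section census

/-- **row sum of a block sequence** (one point, `83` non-zero squares, `83` non-squares): `Σ blk e₀ e₁ e₂ = e₀ + 83 e₁ + 83 e₂`. -/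
lemma sum_blk (e0 e1 e2 : ℤ) : ∑ i : ZMod 167, blk e0 e1 e2 i = e0 + 83 * e1 + 83 * e2 := by
  have h : ∀ i : ZMod 167, blk e0 e1 e2 i = e0 * blk 1 0 0 i + e1 * blk 0 1 0 i + e2 * blk 0 0 1 i := by
    intro i; unfold blk; split_ifs <;> ring
  have s1 : (∑ i : ZMod 167, blk (1 : ℤ) 0 0 i) = 1 := by decide +kernel
  have s2 : (∑ i : ZMod 167, blk (0 : ℤ) 1 0 i) = 83 := by decide +kernel
  have s3 : (∑ i : ZMod 167, blk (0 : ℤ) 0 1 i) = 83 := by decide +kernel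
  rw [Finset.sum_congr rfl (fun i _ => h i), Finset.sum_add_distrib, Finset.sum_add_distrib, ← Finset.mul_sum,
    ← Finset.mul_sum, ← Finset.mul_sum, s1, s2, s3]
  ring

/-- **row sum of a square-invariant sequence on `ZMod 167`**: `Σ x = x 0 + 83 x 1 + 83 x (−1)`. -/
theorem rowsum_of_inv4 (x : ZMod 167 → ℤ) (hinv : ∀ i, x (4 * i) = x i) :
    ∑ i, x i = x 0 + 83 * x 1 + 83 * x (-1) := by
  conv_lhs => rw [eq_blk x hinv]
  exact sum_blk _ _ _

/-- translation does not change the row sum. -/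
lemma sum_translate {n : ℕ} [NeZero n] (x : ZMod n → ℤ) (δ : ZMod n) :
    ∑ i, Literature.Combinatorics.Designs.LegendrePairs.translate x δ i = ∑ i, x i :=
  Fintype.sum_equiv (Equiv.addRight δ) _ _ (fun _ => rfl)

/-- an affine-invariant sequence (`x (u i + d) = x i`) is translation-twisted `u`-invariant. -/
lemma twistedInvariant_of_affine {n : ℕ} [NeZero n] (x : ZMod n → ℤ) (u : (ZMod n)ˣ) (d : ZMod n)
    (h : ∀ i, x ((u : ZMod n) * i + d) = x i) : TwistedInvariant x u := by
  refine ⟨-(((u⁻¹ : (ZMod n)ˣ) : ZMod n) * d), fun i => ?_⟩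
  have e := h (i + -(((u⁻¹ : (ZMod n)ˣ) : ZMod n) * d))
  rw [mul_add, mul_neg, ← mul_assoc, Units.mul_inv, one_mul, neg_add_cancel_right] at e
  exact e

/-- in `ZMod 167`: if `h ≠ 0` and `h² ≠ 1` then `(h^m)² ≠ 1` whenever `gcd(2m, 166) = 2` (used with `m = 2, 4`). -/
lemma pow_sq_ne_one_167 {h : ZMod 167} (h0 : h ≠ 0) (hsq : h ^ 2 ≠ 1) {m : ℕ} (hm : Nat.gcd (2 * m) 166 = 2) :
    (h ^ m) ^ 2 ≠ 1 := by
  haveI : Fact (Nat.Prime 167) := ⟨by norm_num⟩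
  intro h1
  have hF : h ^ 166 = 1 := by simpa using ZMod.pow_card_sub_one_eq_one h0
  rw [← pow_mul, mul_comm] at h1
  have h2 : h ^ Nat.gcd (2 * m) 166 = 1 := pow_gcd_eq_one.2 ⟨h1, hF⟩
  rw [hm] at h2
  exact hsq h2

/-- **a square-invariant translate from an affine symmetry with `u² ≠ 1`** (`u ≠ 0`): if `x (u i + d) = x i` for all
`i` then some translate of `x` is invariant under the non-zero squares. -/
theorem exists_translate_inv4_of_affine (x : ZMod 167 → ℤ) {u : ZMod 167} (hu0 : u ≠ 0) (husq : u ^ 2 ≠ 1)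
    (d : ZMod 167) (h : ∀ i, x (u * i + d) = x i) :
    ∃ δ : ZMod 167, ∀ i, Literature.Combinatorics.Designs.LegendrePairs.translate x δ (4 * i) =
      Literature.Combinatorics.Designs.LegendrePairs.translate x δ i := by
  haveI : Fact (Nat.Prime 167) := ⟨by norm_num⟩
  set U : (ZMod 167)ˣ := Units.mk0 u hu0 with hU
  have hUu : (U : ZMod 167) = u := rfl
  have hU1 : (U : ZMod 167) ≠ 1 := by
    intro h1; apply husq; rw [← hUu, h1, one_pow]
  have htw : TwistedInvariant x U := twistedInvariant_of_affine x U d (fun i => by rw [hUu]; exact h i)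
  obtain ⟨δ, hδ⟩ := exists_translate_hInvariant_prime x U hU1 htw
  exact ⟨δ, inv4_of_hInvariant _ U (by rwa [hUu]) hδ⟩

/-- **Census F11 (a): no multiplier symmetry `a (h x) = ε a x` with `h² ≠ 1` on the `A`-row of a conference pair of
length `167`** (`ε = ±1`; `h = 0` included).  Proof: `a` becomes invariant under `h²`, `(h²)² ≠ 1`, hence under all
non-zero squares, so `Σa = 83 (a 1 + a (−1)) ∈ {0, ±166}` — but `|Σa| = 18`. -/
theorem confPair167_no_multiplierA (a b : ZMod 167 → ℤ) (ha0 : a 0 = 0) (ha : ∀ i, i ≠ 0 → a i = 1 ∨ a i = -1)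
    (hb : IsPM b) (hab : ∀ s : ZMod 167, s ≠ 0 → PAF a s + PAF b s = 0) {h : ZMod 167} (hsq : h ^ 2 ≠ 1)
    {ε : ℤ} (hε : ε = 1 ∨ ε = -1) (hsym : ∀ x, a (h * x) = ε * a x) : False := by
  haveI : Fact (Nat.Prime 167) := ⟨by norm_num⟩
  obtain ⟨hA, -⟩ := confPair167_rowsums a b ha0 ha hb hab
  by_cases h0 : h = 0
  · subst h0
    have e := hsym 1
    rw [zero_mul, ha0] at e
    rcases ha 1 one_ne_zero with e1 | e1 <;> rcases hε with e2 | e2 <;> rw [e1, e2] at e <;> norm_num at e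
  · have h2 : ∀ x, a (h ^ 2 * x) = a x := by
      intro x; rw [sq, mul_assoc, hsym, hsym, ← mul_assoc]
      rcases hε with e | e <;> rw [e] <;> norm_num
    have husq : (h ^ 2) ^ 2 ≠ 1 := pow_sq_ne_one_167 h0 hsq (by decide)
    obtain ⟨δ, hδ⟩ := exists_translate_inv4_of_affine a (pow_ne_zero 2 h0) husq 0 (fun i => by rw [add_zero]; exact h2 i)
    -- the translate by δ is square-invariant; its row sum is that of `a`
    have hs := rowsum_of_inv4 _ hδ
    rw [sum_translate] at hs
    -- values of the translate: at 0, 1, -1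
    have hv : ∀ j : ZMod 167, Literature.Combinatorics.Designs.LegendrePairs.translate a δ j = 0 ∨
        Literature.Combinatorics.Designs.LegendrePairs.translate a δ j = 1 ∨
        Literature.Combinatorics.Designs.LegendrePairs.translate a δ j = -1 := by
      intro j
      unfold Literature.Combinatorics.Designs.LegendrePairs.translate
      by_cases hj : j + δ = 0
      · left; rw [hj, ha0]
      · right; exact ha _ hj
    rcases hv 0 with e0 | e0 | e0 <;> rcases hv 1 with e1 | e1 | e1 <;> rcases hv (-1) with e2 | e2 | e2 <;>
      rw [e0, e1, e2] at hs <;> norm_num at hs <;> rw [hs] at hA <;> norm_num at hA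

/-- **Census F11 (b): no affine symmetry `b (h x + c) = ε b x` with `h² ≠ 1` on the `B`-row of a conference pair of
length `167`** (any shift `c`, `ε = ±1`, `h = 0` included): a translate of `b` is square-invariant, so
`Σb ∈ {±1, ±165, ±167}` — but `|Σb| = 3`. -/
theorem confPair167_no_affineB (a b : ZMod 167 → ℤ) (ha0 : a 0 = 0) (ha : ∀ i, i ≠ 0 → a i = 1 ∨ a i = -1)
    (hb : IsPM b) (hab : ∀ s : ZMod 167, s ≠ 0 → PAF a s + PAF b s = 0) {h : ZMod 167} (hsq : h ^ 2 ≠ 1)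
    (c : ZMod 167) {ε : ℤ} (hε : ε = 1 ∨ ε = -1) (hsym : ∀ x, b (h * x + c) = ε * b x) : False := by
  haveI : Fact (Nat.Prime 167) := ⟨by norm_num⟩
  obtain ⟨-, hB⟩ := confPair167_rowsums a b ha0 ha hb hab
  by_cases h0 : h = 0
  · subst h0
    -- `b` is constant: `b c = ε b x` for all `x`
    have hconst : ∀ x, b x = ε * b c := by
      intro x; have e := hsym x; rw [zero_mul, zero_add] at e
      rw [e, ← mul_assoc]; rcases hε with e' | e' <;> rw [e'] <;> norm_num
    have hs : ∑ i, b i = 167 * (ε * b c) := by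
      rw [Finset.sum_congr rfl (fun i _ => hconst i), Finset.sum_const, Finset.card_univ, ZMod.card]; simp
    rw [hs] at hB
    rcases hε with e | e <;> rcases hb c with e' | e' <;> rw [e, e'] at hB <;> norm_num at hB
  · have h2 : ∀ x, b (h ^ 2 * x + (h * c + c)) = b x := by
      intro x
      have e : h ^ 2 * x + (h * c + c) = h * (h * x + c) + c := by ring
      rw [e, hsym, hsym, ← mul_assoc]
      rcases hε with e' | e' <;> rw [e'] <;> norm_num
    have husq : (h ^ 2) ^ 2 ≠ 1 := pow_sq_ne_one_167 h0 hsq (by decide)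
    obtain ⟨δ, hδ⟩ := exists_translate_inv4_of_affine b (pow_ne_zero 2 h0) husq _ h2
    have hs := rowsum_of_inv4 _ hδ
    rw [sum_translate] at hs
    have hv : ∀ j : ZMod 167, Literature.Combinatorics.Designs.LegendrePairs.translate b δ j = 1 ∨
        Literature.Combinatorics.Designs.LegendrePairs.translate b δ j = -1 := fun j => hb _
    rcases hv 0 with e0 | e0 <;> rcases hv 1 with e1 | e1 <;> rcases hv (-1) with e2 | e2 <;>
      rw [e0, e1, e2] at hs <;> norm_num at hs <;> rw [hs] at hB <;> norm_num at hB

end census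

end Summit.Ventures.DiscreteObjects.Hadamard
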